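import Literature.Analysis.Complex.PolynomialRootCover
import Literature.Analysis.Complex.RiemannExtension
import Mathlib.Analysis.SpecialFunctions.Complex.Log
import Mathlib.Analysis.SpecialFunctions.Complex.LogDeriv
import Mathlib.Analysis.SpecialFunctions.Complex.Arg
import Mathlib.Analysis.Convex.Gauge
import Mathlib.Analysis.Convex.Contractible
import Mathlib.GroupTheory.Perm.Basic
import HarnessLib

/-!
# The analytic Abhyankar–Jung theorem: roots of a quasi-ordinary polynomial after ramification

Topic `Literature/Analysis/Complex` (namespace `Literature.Analysis.Complex.AbhyankarJung`).
Let `T₁, …, T_d ⊆ ℂ` be bounded open convex sets containing `0` and let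
`P_X(Z) = Zⁿ + Σ_{k<n} A_k(X) Zᵏ` have coefficients holomorphic on the polydomain `∏ Tᵢ` and be
separable whenever all `Xᵢ ≠ 0` (the discriminant vanishes at most on the coordinate hyperplanes —
"quasi-ordinary"). Then after a substitution of powers `Xᵢ = Yᵢ^q` the roots are holomorphic:

* `exists_periodic_roots` — on the logarithmic domain `H = {w | exp wᵢ ∈ Tᵢ}` (homeomorphic to a
  convex set, hence simply connected) the pulled-back polynomial has global holomorphic roots
  (`RootCover.exists_global_roots`), and translation by `2πi` in one coordinate permutes them, so
  they are `2πi q`-periodic in every coordinate for `q = n!`;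
* `exists_roots_pow` — **analytic Abhyankar–Jung**: there are `q ≥ 1` and holomorphic
  `f₁, …, fₙ` on `{Y | Yᵢ^q ∈ Tᵢ}` with `P_{Y^q} = ∏ₗ (Z − fₗ Y)`; the periodic roots descend through
  `Yᵢ ↦ q log Yᵢ` off the coordinate hyperplanes, are bounded there (roots of a monic polynomial
  with bounded coefficients) and extend across the hyperplanes by the Riemann extension theorem
  (`SCV.exists_differentiableOn_eqOn_of_thin`).

This is Parusiński–Rond, Prop. 2.1 (Jung's argument), with the fundamental group of the punctured
polydisc replaced by explicit periodicity on the logarithmic cover. Everything is proved; no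
definitions, no named facts.

## References

* A. Parusiński, G. Rond, *The Abhyankar–Jung theorem*, J. Algebra 365 (2012) 29–41, Prop. 2.1.
* H. W. E. Jung, *Darstellung der Funktionen eines algebraischen Körpers zweier unabhängigen
  Veränderlichen …*, J. Reine Angew. Math. 133 (1908) 289–314.
-/

noncomputable section

open Complex Metric Set Filter Polynomial Topology
open scoped Real

namespace Literature.Analysis.Complex
namespace AbhyankarJung

variable {d : ℕ}

/-! ### The logarithmic domain `{w | exp wᵢ ∈ Tᵢ}` -/

/-- The logarithmic domain is open. [folklore] -/
theorem isOpen_logSet {T : Fin d → Set ℂ} (hTo : ∀ i, IsOpen (T i)) :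
    IsOpen {w : Fin d → ℂ | ∀ i, exp (w i) ∈ T i} := by
  have : {w : Fin d → ℂ | ∀ i, exp (w i) ∈ T i} = ⋂ i, (fun w : Fin d → ℂ => exp (w i)) ⁻¹' T i := by
    ext w; simp
  rw [this]
  exact isOpen_iInter_of_finite fun i => (hTo i).preimage (by fun_prop)

/-- Translation by `c` in the `i`-th coordinate. [folklore] -/
theorem add_smul_single_apply (w : Fin d → ℂ) (c : ℂ) (i j : Fin d) :
    (w + c • (Pi.single i (1 : ℂ) : Fin d → ℂ)) j = w j + if j = i then c else 0 := by
  by_cases h : j = i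
  · subst h; simp
  · simp [h]

/-- The logarithmic domain is invariant under `w ↦ w + 2πi m eᵢ`, `m ∈ ℤ`. [folklore] -/
theorem mem_logSet_add_int {T : Fin d → Set ℂ} {w : Fin d → ℂ} (hw : ∀ i, exp (w i) ∈ T i)
    (i : Fin d) (m : ℤ) : ∀ j, exp ((w + ((m : ℂ) * (2 * π * I)) • (Pi.single i (1 : ℂ) : Fin d → ℂ)) j) ∈ T j := by
  intro j
  rw [add_smul_single_apply]
  by_cases h : j = i
  · rw [if_pos h, exp_add, exp_int_mul_two_pi_mul_I, mul_one]; exact hw j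
  · rw [if_neg h, add_zero]; exact hw j

/-- A bounded set containing a neighbourhood of `0` has positive gauge at every non-zero vector.
[folklore] -/
theorem gauge_pos_of_isBounded {s : Set ℂ} (hb : Bornology.IsBounded s) (hs : s ∈ 𝓝 (0 : ℂ))
    {x : ℂ} (hx : x ≠ 0) : 0 < gauge s x := by
  obtain ⟨r, hr⟩ := hb.subset_closedBall 0
  have hr0 : 0 < max r 1 := lt_max_of_lt_right one_pos
  have h : ‖x‖ / max r 1 ≤ gauge s x := le_gauge_of_subset_closedBall (absorbent_nhds_zero hs) hr0.le
    (hr.trans (closedBall_subset_closedBall (le_max_left _ _)))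
  exact lt_of_lt_of_le (div_pos (norm_pos_iff.2 hx) hr0) h

/-- Membership in an open convex set containing `0` in terms of the gauge of the direction:
`exp w ∈ s ↔ re w + log (gauge s (exp (im w · I))) < 0`. [folklore] -/
theorem exp_mem_iff_re_add_log_gauge_lt {s : Set ℂ} (hso : IsOpen s) (hsc : Convex ℝ s)
    (hb : Bornology.IsBounded s) (h0 : (0 : ℂ) ∈ s) (w : ℂ) :
    exp w ∈ s ↔ w.re + Real.log (gauge s (exp (w.im * I))) < 0 := by
  have hs : s ∈ 𝓝 (0 : ℂ) := hso.mem_nhds h0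
  have hgpos : 0 < gauge s (exp (w.im * I)) := gauge_pos_of_isBounded hb hs (exp_ne_zero _)
  have hexp : exp w = (Real.exp w.re : ℝ) • exp (w.im * I) := by
    rw [exp_eq_exp_re_mul_sin_add_cos, ← exp_mul_I]
    simp [Algebra.smul_def]
  have hg : gauge s (exp w) = Real.exp w.re * gauge s (exp (w.im * I)) := by
    rw [hexp, gauge_smul_of_nonneg (Real.exp_pos _).le, smul_eq_mul]
  constructor
  · intro h
    have h1 : gauge s (exp w) < 1 := gauge_lt_one_of_mem_of_isOpen hso h
    rw [hg] at h1
    have h2 : Real.log (Real.exp w.re * gauge s (exp (w.im * I))) < Real.log 1 :=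
      Real.log_lt_log (mul_pos (Real.exp_pos _) hgpos) h1
    rwa [Real.log_mul (Real.exp_pos _).ne' hgpos.ne', Real.log_exp, Real.log_one] at h2
  · intro h
    have h1 : gauge s (exp w) < 1 := by
      rw [hg, ← Real.exp_log hgpos, ← Real.exp_add, ← Real.exp_zero]
      exact Real.exp_lt_exp.2 h
    have h2 : exp w ∈ {x | gauge s x < 1} := h1
    rwa [setOf_gauge_lt_one_eq_self_of_isOpen hsc h0 hso] at h2

/-- **The logarithmic domain is simply connected**: `w ↦ (wᵢ + log gauge_{Tᵢ}(e^{i·im wᵢ}))ᵢ` is a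
homeomorphism of `ℂᵈ` carrying `{w | exp wᵢ ∈ Tᵢ}` onto the convex set `{w | re wᵢ < 0}`.
[folklore] -/
theorem simplyConnectedSpace_logSet {T : Fin d → Set ℂ} (hTo : ∀ i, IsOpen (T i))
    (hTc : ∀ i, Convex ℝ (T i)) (hTb : ∀ i, Bornology.IsBounded (T i)) (hT0 : ∀ i, (0 : ℂ) ∈ T i) :
    SimplyConnectedSpace {w : Fin d → ℂ | ∀ i, exp (w i) ∈ T i} := by
  -- the correction `ℓ i v = log gauge (T i) (exp (v I))`, continuous in `v`
  set ℓ : Fin d → ℝ → ℝ := fun i v => Real.log (gauge (T i) (exp (v * I))) with hℓ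
  have hTn : ∀ i, T i ∈ 𝓝 (0 : ℂ) := fun i => (hTo i).mem_nhds (hT0 i)
  have hℓc : ∀ i, Continuous (ℓ i) := by
    intro i
    refine Continuous.log ((continuous_gauge (hTc i) (hTn i)).comp (by fun_prop)) fun v => ?_
    exact (gauge_pos_of_isBounded (hTb i) (hTn i) (exp_ne_zero _)).ne'
  -- the straightening homeomorphism of `ℂᵈ`
  have him : ∀ (z : ℂ) (t : ℝ), (z + (t : ℂ)).im = z.im := fun z t => by simp
  let Φ : (Fin d → ℂ) ≃ₜ (Fin d → ℂ) :=
    { toFun := fun w i => w i + (ℓ i (w i).im : ℂ)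
      invFun := fun w i => w i + (-(ℓ i (w i).im) : ℂ)
      left_inv := fun w => by
        funext i
        dsimp only
        rw [him]; ring
      right_inv := fun w => by
        funext i
        have : (w i + -(ℓ i (w i).im : ℂ)).im = (w i).im := by simp
        dsimp only
        rw [this]; ring
      continuous_toFun := by
        refine continuous_pi fun i => ?_
        exact ((continuous_apply i).add
          (continuous_ofReal.comp ((hℓc i).comp (continuous_im.comp (continuous_apply i)))))
      continuous_invFun := by
        refine continuous_pi fun i => ?_
        exact ((continuous_apply i).add (continuous_ofReal.comp
          ((hℓc i).comp (continuous_im.comp (continuous_apply i)))).neg) }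
  have hΦ : ∀ w : Fin d → ℂ, (∀ i, exp (w i) ∈ T i) ↔ ∀ i, (Φ w i).re < 0 := by
    intro w
    refine forall_congr' fun i => ?_
    rw [exp_mem_iff_re_add_log_gauge_lt (hTo i) (hTc i) (hTb i) (hT0 i)]
    simp [Φ, ℓ]
  -- the target is convex, hence contractible, hence simply connected
  have hconv : Convex ℝ {w : Fin d → ℂ | ∀ i, (w i).re < 0} := by
    have : {w : Fin d → ℂ | ∀ i, (w i).re < 0} =
        ⋂ i, {w : Fin d → ℂ | (w i).re < 0} := by ext w; simp
    rw [this]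
    exact convex_iInter fun i =>
      convex_halfSpace_lt ⟨fun x y => by simp, fun c x => by simp⟩ 0
  have hne : ({w : Fin d → ℂ | ∀ i, (w i).re < 0}).Nonempty :=
    ⟨fun _ => -1, fun i => by simp⟩
  haveI : ContractibleSpace {w : Fin d → ℂ | ∀ i, (w i).re < 0} := hconv.contractibleSpace hne
  have e : {w : Fin d → ℂ | ∀ i, exp (w i) ∈ T i} ≃ₜ {w : Fin d → ℂ | ∀ i, (w i).re < 0} :=
    Φ.subtype hΦ
  exact e.toHomotopyEquiv.simplyConnectedSpace

/-! ### Periodic global roots on the logarithmic domain -/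

/-- **Periodic roots on the logarithmic cover.** Let the coefficients `bₖ` be holomorphic on the
logarithmic domain `H = {w | exp wᵢ ∈ Tᵢ}` (each `Tᵢ` bounded, open, convex, `0 ∈ Tᵢ`),
`2πi`-periodic in every coordinate, with `P_w` separable on `H`. Then `P_w = ∏ₗ (Z − gₗ w)` with
`gₗ` holomorphic on `H` and `2πi q`-periodic in every coordinate, `q = n!`: the roots exist globally
because `H` is simply connected; `w ↦ gₗ(w + 2πi eᵢ)` is again a continuous root, hence equals
`g_{σᵢ l}` for a permutation `σᵢ` (connectedness of `H`), and `σᵢ^{n!} = 1`.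
[Parusiński–Rond 2012, Prop. 2.1 (proof)] [cite: ParusinskiRond2012, Prop. 2.1] -/
theorem exists_periodic_roots {n : ℕ} {T : Fin d → Set ℂ} (hTo : ∀ i, IsOpen (T i))
    (hTc : ∀ i, Convex ℝ (T i)) (hTb : ∀ i, Bornology.IsBounded (T i)) (hT0 : ∀ i, (0 : ℂ) ∈ T i)
    {b : Fin n → (Fin d → ℂ) → ℂ} (hb : ∀ k, DifferentiableOn ℂ (b k) {w | ∀ i, exp (w i) ∈ T i})
    (hper : ∀ k i w, b k (w + (2 * π * I) • (Pi.single i (1 : ℂ) : Fin d → ℂ)) = b k w)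
    (hsep : ∀ w : Fin d → ℂ, (∀ i, exp (w i) ∈ T i) →
      (X ^ n + ∑ k : Fin n, C (b k w) * X ^ (k : ℕ)).Separable) :
    ∃ q : ℕ, 0 < q ∧ ∃ g : Fin n → (Fin d → ℂ) → ℂ,
      (∀ l, DifferentiableOn ℂ (g l) {w | ∀ i, exp (w i) ∈ T i}) ∧
      (∀ w : Fin d → ℂ, (∀ i, exp (w i) ∈ T i) →
        (X ^ n + ∑ k : Fin n, C (b k w) * X ^ (k : ℕ)) = ∏ l, (X - C (g l w))) ∧
      ∀ l i (m : ℤ) (w : Fin d → ℂ), (∀ i, exp (w i) ∈ T i) →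
        g l (w + ((m : ℂ) * ((q : ℂ) * (2 * π * I))) • (Pi.single i (1 : ℂ) : Fin d → ℂ)) = g l w := by
  classical
  set H : Set (Fin d → ℂ) := {w | ∀ i, exp (w i) ∈ T i} with hH
  have hHo : IsOpen H := isOpen_logSet hTo
  haveI : SimplyConnectedSpace H := simplyConnectedSpace_logSet hTo hTc hTb hT0
  obtain ⟨g, hgd, hgprod⟩ := RootCover.exists_global_roots hHo hb hsep
  have hgc : ∀ l, ContinuousOn (g l) H := fun l => (hgd l).continuousOn
  set e : Fin d → Fin d → ℂ := fun i => (Pi.single i (1 : ℂ) : Fin d → ℂ) with he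
  -- roots are the `g l w`, pairwise distinct
  have hroots : ∀ w ∈ H, ∀ z : ℂ,
      (X ^ n + ∑ k : Fin n, C (b k w) * X ^ (k : ℕ)).IsRoot z → ∃ m, g m w = z := by
    intro w hw z hz
    rw [hgprod w hw, IsRoot.def, eval_prod, Finset.prod_eq_zero_iff] at hz
    obtain ⟨m, -, hm⟩ := hz
    exact ⟨m, (by simpa [sub_eq_zero] using hm : z = g m w).symm⟩
  have hginj : ∀ w ∈ H, Function.Injective fun m => g m w := by
    intro w hw m m' h
    have hnd := nodup_roots (hsep w hw)
    rw [hgprod w hw] at hnd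
    have hrw : (∏ l, (X - C (g l w)) : ℂ[X]) =
        ((Finset.univ.val.map fun l => g l w).map fun a => X - C a).prod := by
      rw [Finset.prod_eq_multiset_prod, Multiset.map_map]; rfl
    have hnd' : (Finset.univ.val.map fun l => g l w).Nodup := by
      have : (∏ l, (X - C (g l w)) : ℂ[X]).roots = Finset.univ.val.map fun l => g l w := by
        rw [hrw, Polynomial.roots_multiset_prod_X_sub_C]
      rwa [this] at hnd
    exact (Multiset.nodup_map_iff_inj_on Finset.univ.nodup).1 hnd' m
      (by simp) m' (by simp) h
  -- the shift `w ↦ w + 2πi eᵢ` preserves `H` and the polynomial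
  set c : ℂ := 2 * π * I with hc
  have hshift : ∀ w ∈ H, ∀ i, w + c • e i ∈ H := by
    intro w hw i j
    have := mem_logSet_add_int hw i 1 j
    simpa [hc, he] using this
  have hshift_root : ∀ i l, ∀ w ∈ H, ∃ m, g m w = g l (w + c • e i) := by
    intro i l w hw
    refine hroots w hw _ ?_
    have h1 : (X ^ n + ∑ k : Fin n, C (b k (w + c • e i)) * X ^ (k : ℕ)).IsRoot
        (g l (w + c • e i)) := by
      rw [hgprod _ (hshift w hw i), IsRoot.def, eval_prod]
      exact Finset.prod_eq_zero (Finset.mem_univ l) (by simp)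
    have h2 : ∀ k, b k (w + c • e i) = b k w := fun k => hper k i w
    simp only [h2] at h1
    exact h1
  -- a point of `H`
  haveI : PathConnectedSpace H := inferInstance
  obtain ⟨⟨w₀, hw₀⟩⟩ : Nonempty H := inferInstance
  -- the index of the shifted root is locally constant, hence constant on the connected `H`
  have hconst : ∀ i l, ∃ m, ∀ w ∈ H, g l (w + c • e i) = g m w := by
    intro i l
    let ι : H → Fin n := fun w => Classical.choose (hshift_root i l w w.2)
    have hι : ∀ w : H, g (ι w) w = g l ((w : Fin d → ℂ) + c • e i) := fun w =>
      Classical.choose_spec (hshift_root i l w w.2)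
    have hloc : IsLocallyConstant ι := by
      refine (IsLocallyConstant.iff_eventually_eq ι).2 fun w => ?_
      -- near `w`, the shifted root follows the branch `g (ι w)`
      have hcontshift : ContinuousWithinAt (fun v => g l (v + c • e i)) H w := by
        have h1 : ContinuousWithinAt (g l) H ((w : Fin d → ℂ) + c • e i) := hgc l _ (hshift w w.2 i)
        have h2 : ContinuousWithinAt (fun v : Fin d → ℂ => v + c • e i) H (w : Fin d → ℂ) :=
          (continuous_id.add continuous_const).continuousWithinAt
        exact ContinuousWithinAt.comp (g := g l) (f := fun v : Fin d → ℂ => v + c • e i)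
          (x := (w : Fin d → ℂ)) h1 h2 fun v hv => hshift v hv i
      have hev := RootCover.eventuallyEq_of_mem_range (f := fun v => g l (v + c • e i))
        (r := g) (s := H) (y := (w : Fin d → ℂ)) (m₀ := ι w) hcontshift
        (fun m => (hgc m).continuousAt (hHo.mem_nhds w.2)) (hginj w w.2) (hι w).symm
        fun v hv => by obtain ⟨m, hm⟩ := hshift_root i l v hv; exact ⟨m, hm.symm⟩
      -- translate to the subtype
      have hev' : ∀ᶠ v : H in 𝓝 w, g l ((v : Fin d → ℂ) + c • e i) = g (ι w) v := by
        have h1 : ∀ᶠ v in 𝓝 (w : Fin d → ℂ), v ∈ H → g l (v + c • e i) = g (ι w) v := by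
          rwa [EventuallyEq, eventually_nhdsWithin_iff] at hev
        exact (continuous_subtype_val.continuousAt.eventually h1).mono fun v hv => hv v.2
      exact hev'.mono fun v hv => hginj v v.2 ((hι v).trans hv)
    exact ⟨ι ⟨w₀, hw₀⟩, fun w hw => by
      have h1 := hι ⟨w, hw⟩
      rw [hloc.apply_eq_of_preconnectedSpace ⟨w, hw⟩ ⟨w₀, hw₀⟩] at h1
      exact h1.symm⟩
  choose τ hτ using hconst
  -- `τ i` is a permutation
  have hτinj : ∀ i, Function.Injective (τ i) := by
    intro i l l' h
    have h1 := hτ i l w₀ hw₀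
    have h2 := hτ i l' w₀ hw₀
    rw [h] at h1
    exact hginj _ (hshift w₀ hw₀ i) (h1.trans h2.symm)
  let σ : Fin d → Equiv.Perm (Fin n) := fun i => Equiv.ofBijective (τ i) ((hτinj i).bijective_of_finite)
  have hσ : ∀ i l, ∀ w ∈ H, g l (w + c • e i) = g (σ i l) w := fun i l w hw => hτ i l w hw
  -- iterates of the shift
  have hiter : ∀ i (k : ℕ) l, ∀ w ∈ H, g l (w + ((k : ℂ) * c) • e i) = g ((σ i ^ k) l) w := by
    intro i k
    induction k with
    | zero => intro l w hw; simp
    | succ k ih =>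
      intro l w hw
      have hw' : w + c • e i ∈ H := hshift w hw i
      have h1 : w + (((k + 1 : ℕ) : ℂ) * c) • e i = (w + c • e i) + ((k : ℂ) * c) • e i := by
        rw [add_assoc, ← add_smul]; push_cast; ring_nf
      rw [h1, ih l _ hw', hσ i _ w hw, pow_succ', Equiv.Perm.mul_apply]
  -- the period `q = n!`
  set q : ℕ := Fintype.card (Equiv.Perm (Fin n)) with hq
  have hqpos : 0 < q := Fintype.card_pos
  have hσq : ∀ i, σ i ^ q = 1 := fun i => pow_card_eq_one
  refine ⟨q, hqpos, g, hgd, hgprod, fun l i m w hw => ?_⟩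
  -- one period
  have hQ : ∀ v ∈ H, g l (v + ((q : ℂ) * c) • e i) = g l v := by
    intro v hv
    rw [hiter i q l v hv, hσq i, Equiv.Perm.one_apply]
  -- shifted points stay in `H`
  have hmem : ∀ (m : ℤ) (v : Fin d → ℂ), v ∈ H → v + ((m : ℂ) * ((q : ℂ) * c)) • e i ∈ H := by
    intro m v hv
    have h1 : ((m : ℂ) * ((q : ℂ) * c)) = (((m * q : ℤ)) : ℂ) * (2 * π * I) := by
      push_cast; rw [hc]; ring
    rw [h1]
    exact mem_logSet_add_int hv i (m * q)
  -- integer multiples of the period, by induction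
  change w ∈ H at hw
  induction m using Int.induction_on generalizing w with
  | zero => simp
  | succ k ih =>
    have hw1 : w + (((k : ℤ) : ℂ) * ((q : ℂ) * c)) • e i ∈ H := hmem k w hw
    have h1 : w + ((((k : ℤ) + 1 : ℤ) : ℂ) * ((q : ℂ) * c)) • e i =
        (w + (((k : ℤ) : ℂ) * ((q : ℂ) * c)) • e i) + ((q : ℂ) * c) • e i := by
      rw [add_assoc, ← add_smul]; push_cast; ring_nf
    rw [h1, hQ _ hw1]
    exact ih w hw
  | pred k ih =>
    have hw1 : w + (((-(k : ℤ) - 1 : ℤ) : ℂ) * ((q : ℂ) * c)) • e i ∈ H := hmem _ w hw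
    have h1 : (w + (((-(k : ℤ) - 1 : ℤ) : ℂ) * ((q : ℂ) * c)) • e i) + ((q : ℂ) * c) • e i =
        w + (((-(k : ℤ) : ℤ) : ℂ) * ((q : ℂ) * c)) • e i := by
      rw [add_assoc, ← add_smul]; push_cast; ring_nf
    have h2 := hQ _ hw1
    rw [h1] at h2
    rw [← ih w hw, h2]

/-! ### Auxiliary facts -/

/-- **Cauchy bound**: a root of `Zⁿ + Σ cₖ Zᵏ` has norm at most `max 1 (Σ ‖cₖ‖)`. [folklore] -/
theorem norm_root_le {n : ℕ} (c : Fin n → ℂ) {z : ℂ}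
    (hz : (X ^ n + ∑ k : Fin n, C (c k) * X ^ (k : ℕ)).IsRoot z) :
    ‖z‖ ≤ max 1 (∑ k : Fin n, ‖c k‖) := by
  by_cases h1 : ‖z‖ ≤ 1
  · exact h1.trans (le_max_left _ _)
  push Not at h1
  refine le_trans ?_ (le_max_right _ _)
  have hz0 : z ≠ 0 := fun h => by rw [h, norm_zero] at h1; exact (lt_irrefl _ (h1.trans one_pos)).elim
  have heval : z ^ n + ∑ k : Fin n, c k * z ^ (k : ℕ) = 0 := by
    have := hz.eq_zero
    simpa [eval_finsetSum] using this
  cases n with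
  | zero => simp at heval
  | succ n =>
    have hzn : z ^ (n + 1) = -∑ k : Fin (n + 1), c k * z ^ (k : ℕ) := eq_neg_of_add_eq_zero_left heval
    have hle : ‖z‖ ^ (n + 1) ≤ (∑ k : Fin (n + 1), ‖c k‖) * ‖z‖ ^ n := by
      calc ‖z‖ ^ (n + 1) = ‖z ^ (n + 1)‖ := (norm_pow _ _).symm
        _ = ‖∑ k : Fin (n + 1), c k * z ^ (k : ℕ)‖ := by rw [hzn, norm_neg]
        _ ≤ ∑ k : Fin (n + 1), ‖c k * z ^ (k : ℕ)‖ := norm_sum_le _ _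
        _ ≤ ∑ k : Fin (n + 1), ‖c k‖ * ‖z‖ ^ n := Finset.sum_le_sum fun k _ => ?_
        _ = (∑ k : Fin (n + 1), ‖c k‖) * ‖z‖ ^ n := (Finset.sum_mul _ _ _).symm
      rw [norm_mul, norm_pow]
      refine mul_le_mul_of_nonneg_left ?_ (norm_nonneg _)
      exact pow_le_pow_right₀ h1.le (Nat.lt_succ_iff.1 k.2)
    have hzpos : 0 < ‖z‖ ^ n := pow_pos (one_pos.trans h1) n
    rw [pow_succ] at hle
    exact le_of_mul_le_mul_right (by linarith [hle]) hzpos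

/-- The union of the coordinate hyperplanes does not contain a neighbourhood of any point: the
product of the coordinates is not identically zero near any `a ∈ ℂᵈ`. [folklore] -/
theorem not_eventually_prod_eq_zero (a : Fin d → ℂ) :
    ¬ (fun Y : Fin d → ℂ => ∏ i, Y i) =ᶠ[𝓝 a] 0 := by
  intro h
  -- along the curve `t ↦ a + t 𝟙`, `t → 0`, `t ≠ 0`, the product is eventually non-zero
  have hcurve : Tendsto (fun t : ℝ => fun i => a i + t) (𝓝[≠] 0) (𝓝 a) := by
    have : Tendsto (fun t : ℝ => fun i => a i + t) (𝓝 0) (𝓝 a) := by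
      have hc : Continuous fun t : ℝ => fun i => a i + (t : ℂ) := by fun_prop
      simpa using hc.tendsto 0
    exact this.mono_left nhdsWithin_le_nhds
  have hbad : ∀ᶠ t : ℝ in 𝓝[≠] 0, ∀ i, a i + t ≠ 0 := by
    refine (eventually_all.2 fun i => ?_)
    by_cases hi : ∃ t₀ : ℝ, a i + t₀ = 0
    · obtain ⟨t₀, ht₀⟩ := hi
      by_cases h0 : t₀ = 0
      · -- `a i = 0`: then `a i + t = t ≠ 0` on the punctured neighbourhood
        subst h0
        have hai : a i = 0 := by simpa using ht₀
        filter_upwards [self_mem_nhdsWithin] with t ht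
        simpa [hai] using ht
      · have h1 : ∀ᶠ t : ℝ in 𝓝 (0 : ℝ), t ≠ t₀ := isOpen_ne.mem_nhds (Ne.symm h0)
        have : ∀ᶠ t : ℝ in 𝓝[≠] 0, t ≠ t₀ := h1.filter_mono nhdsWithin_le_nhds
        filter_upwards [this] with t ht heq
        apply ht
        have h1 : (t : ℂ) = t₀ := by
          have e1 : (t : ℂ) = -a i := eq_neg_of_add_eq_zero_right heq
          have e2 : (t₀ : ℂ) = -a i := eq_neg_of_add_eq_zero_right ht₀
          rw [e1, e2]
        exact_mod_cast h1
    · push Not at hi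
      exact Eventually.of_forall fun t => hi t
  have hzero : ∀ᶠ t : ℝ in 𝓝[≠] 0, (∏ i, (a i + (t : ℂ))) = 0 := by
    have := hcurve.eventually h
    exact this.mono fun t ht => by simpa using ht
  have hfalse : ∀ᶠ t : ℝ in 𝓝[≠] (0 : ℝ), False := by
    filter_upwards [hbad, hzero] with t h1 h2
    exact (Finset.prod_ne_zero_iff.2 fun i _ => h1 i) h2
  exact (NormedField.nhdsNE_neBot (0 : ℝ)).ne (eventually_false_iff_eq_bot.1 hfalse)

/-! ### Roots after ramification -/

/-- **Analytic Abhyankar–Jung theorem.** Let `T₁, …, T_d ⊆ ℂ` be bounded open convex sets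
containing `0`, and let `P_X = Zⁿ + Σ Aₖ(X) Zᵏ` have coefficients holomorphic on the polydomain
`{X | Xᵢ ∈ Tᵢ}` and be separable whenever all `Xᵢ ≠ 0`. Then there are `q ≥ 1` and holomorphic
functions `f₁, …, fₙ` on `{Y | Yᵢ^q ∈ Tᵢ}` with `P_{Y^q} = ∏ₗ (Z − fₗ Y)` there. Proof: the
coefficients `Aₖ ∘ exp` on the logarithmic domain are `2πi`-periodic, so by `exists_periodic_roots`
the roots `gₗ` are holomorphic and `2πi q`-periodic there; `fₗ Y := gₗ(q log Y)` (any branch) is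
well defined and holomorphic off the coordinate hyperplanes, bounded near them (Cauchy bound), hence
extends holomorphically across them (Riemann extension theorem, `SCV.exists_differentiableOn_eqOn_of_thin`);
the factorisation extends by continuity and density.
[Parusiński–Rond 2012, Prop. 2.1] [cite: ParusinskiRond2012, Prop. 2.1] -/
theorem exists_roots_pow {n : ℕ} {T : Fin d → Set ℂ} (hTo : ∀ i, IsOpen (T i))
    (hTc : ∀ i, Convex ℝ (T i)) (hTb : ∀ i, Bornology.IsBounded (T i)) (hT0 : ∀ i, (0 : ℂ) ∈ T i)
    {A : Fin n → (Fin d → ℂ) → ℂ} (hA : ∀ k, DifferentiableOn ℂ (A k) {x | ∀ i, x i ∈ T i})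
    (hsep : ∀ x : Fin d → ℂ, (∀ i, x i ∈ T i) → (∀ i, x i ≠ 0) →
      (X ^ n + ∑ k : Fin n, C (A k x) * X ^ (k : ℕ)).Separable) :
    ∃ q : ℕ, 0 < q ∧ ∃ f : Fin n → (Fin d → ℂ) → ℂ,
      (∀ l, DifferentiableOn ℂ (f l) {Y | ∀ i, Y i ^ q ∈ T i}) ∧
      ∀ Y : Fin d → ℂ, (∀ i, Y i ^ q ∈ T i) →
        (X ^ n + ∑ k : Fin n, C (A k (fun i => Y i ^ q)) * X ^ (k : ℕ)) = ∏ l, (X - C (f l Y)) := by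
  classical
  set D : Set (Fin d → ℂ) := {x | ∀ i, x i ∈ T i} with hD
  set H : Set (Fin d → ℂ) := {w | ∀ i, exp (w i) ∈ T i} with hH
  have hDo : IsOpen D := by
    have : D = ⋂ i, (fun x : Fin d → ℂ => x i) ⁻¹' T i := by ext x; simp [hD]
    rw [this]; exact isOpen_iInter_of_finite fun i => (hTo i).preimage (continuous_apply i)
  -- the pulled-back coefficients on the logarithmic domain
  set EXP : (Fin d → ℂ) → (Fin d → ℂ) := fun w i => exp (w i) with hEXP
  have hEXPd : Differentiable ℂ EXP := by
    refine differentiable_pi.2 fun i => ?_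
    exact Complex.differentiable_exp.comp (differentiable_apply i)
  have hEXPH : ∀ w ∈ H, EXP w ∈ D := fun w hw i => hw i
  set b : Fin n → (Fin d → ℂ) → ℂ := fun k w => A k (EXP w) with hb
  have hbd : ∀ k, DifferentiableOn ℂ (b k) H := fun k =>
    (hA k).comp hEXPd.differentiableOn hEXPH
  set c : ℂ := 2 * π * I with hc
  have hEXPper : ∀ i w, EXP (w + c • (Pi.single i (1 : ℂ) : Fin d → ℂ)) = EXP w := by
    intro i w; funext j
    simp only [hEXP]
    rw [add_smul_single_apply]
    by_cases h : j = i
    · rw [if_pos h, exp_add, hc, exp_two_pi_mul_I, mul_one]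
    · rw [if_neg h, add_zero]
  have hbper : ∀ k i w, b k (w + (2 * π * I) • (Pi.single i (1 : ℂ) : Fin d → ℂ)) = b k w := by
    intro k i w; simp only [hb]; rw [← hc, hEXPper]
  have hbsep : ∀ w : Fin d → ℂ, (∀ i, exp (w i) ∈ T i) →
      (X ^ n + ∑ k : Fin n, C (b k w) * X ^ (k : ℕ)).Separable := fun w hw =>
    hsep (EXP w) hw fun i => exp_ne_zero _
  obtain ⟨q, hqpos, g, hgd, hgprod, hgper⟩ := exists_periodic_roots hTo hTc hTb hT0 hbd hbper hbsep
  -- the ramified domain, the axes, and the logarithms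
  set U : Set (Fin d → ℂ) := {Y | ∀ i, Y i ^ q ∈ T i} with hU
  set Ax : Set (Fin d → ℂ) := {Y | ∃ i, Y i = 0} with hAx
  have hUo : IsOpen U := by
    have : U = ⋂ i, (fun Y : Fin d → ℂ => Y i ^ q) ⁻¹' T i := by ext Y; simp [hU]
    rw [this]; exact isOpen_iInter_of_finite fun i => (hTo i).preimage (by fun_prop)
  have hUA : U \ Ax = {Y | (∀ i, Y i ^ q ∈ T i) ∧ ∀ i, Y i ≠ 0} := by
    ext Y; simp [hU, hAx]
  have hUAo : IsOpen (U \ Ax) := by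
    rw [hUA]
    have : {Y : Fin d → ℂ | (∀ i, Y i ^ q ∈ T i) ∧ ∀ i, Y i ≠ 0} =
        U ∩ ⋂ i, (fun Y : Fin d → ℂ => Y i) ⁻¹' {0}ᶜ := by ext Y; simp [hU]
    rw [this]
    exact hUo.inter (isOpen_iInter_of_finite fun i =>
      isOpen_compl_singleton.preimage (continuous_apply i))
  have hpowD : ∀ Y ∈ U, (fun i => Y i ^ q) ∈ D := fun Y hY i => hY i
  -- `q log Y` lies in `H` when no coordinate vanishes, and `exp` of it is `Y^q`
  set LOG : (Fin d → ℂ) → (Fin d → ℂ) := fun Y i => (q : ℂ) * log (Y i) with hLOG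
  have hEXPLOG : ∀ Y : Fin d → ℂ, (∀ i, Y i ≠ 0) → EXP (LOG Y) = fun i => Y i ^ q := by
    intro Y hY; funext i
    simp only [hEXP, hLOG]
    rw [exp_nat_mul, exp_log (hY i)]
  have hLOGH : ∀ Y ∈ U \ Ax, LOG Y ∈ H := by
    intro Y hY i
    rw [hUA] at hY
    have := congrFun (hEXPLOG Y hY.2) i
    simp only [hEXP] at this
    show exp (LOG Y i) ∈ T i
    rw [this]; exact hY.1 i
  -- periodicity of `g l` along integer vectors of periods
  have hgperv : ∀ l (kv : Fin d → ℤ) (v : Fin d → ℂ), v ∈ H →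
      g l (v + fun j => (kv j : ℂ) * ((q : ℂ) * c)) = g l v := by
    intro l kv
    -- write the shift as a sum over coordinates and induct
    have hsum : ∀ S : Finset (Fin d), (fun j => if j ∈ S then (kv j : ℂ) * ((q : ℂ) * c) else 0) =
        ∑ i ∈ S, ((kv i : ℂ) * ((q : ℂ) * c)) • (Pi.single i (1 : ℂ) : Fin d → ℂ) := by
      intro S; funext j
      simp only [Finset.sum_apply, Pi.smul_apply, Pi.single_apply, smul_eq_mul, mul_ite, mul_one,
        mul_zero]
      rw [Finset.sum_ite_eq]
    have hmemS : ∀ (S : Finset (Fin d)) (v : Fin d → ℂ), v ∈ H →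
        v + (fun j => if j ∈ S then (kv j : ℂ) * ((q : ℂ) * c) else 0) ∈ H := by
      intro S v hv j
      show exp ((v + fun j => if j ∈ S then (kv j : ℂ) * ((q : ℂ) * c) else 0) j) ∈ T j
      simp only [Pi.add_apply]
      split_ifs
      · rw [exp_add, show (kv j : ℂ) * ((q : ℂ) * c) = ((kv j * q : ℤ) : ℂ) * (2 * π * I) by
          push_cast; rw [hc]; ring, exp_int_mul_two_pi_mul_I, mul_one]
        exact hv j
      · rw [add_zero]; exact hv j
    suffices h : ∀ S : Finset (Fin d), ∀ v ∈ H,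
        g l (v + fun j => if j ∈ S then (kv j : ℂ) * ((q : ℂ) * c) else 0) = g l v by
      intro v hv
      have := h Finset.univ v hv
      simpa using this
    intro S
    induction S using Finset.induction_on with
    | empty =>
      intro v hv
      have : (fun j : Fin d => if j ∈ (∅ : Finset (Fin d)) then (kv j : ℂ) * ((q : ℂ) * c) else 0) = 0 := by
        funext j; simp
      rw [this, add_zero]
    | insert a S haS ih =>
      intro v hv
      have hsplit : (v + fun j => if j ∈ insert a S then (kv j : ℂ) * ((q : ℂ) * c) else 0) =
          (v + fun j => if j ∈ S then (kv j : ℂ) * ((q : ℂ) * c) else 0) +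
            ((kv a : ℂ) * ((q : ℂ) * c)) • (Pi.single a (1 : ℂ) : Fin d → ℂ) := by
        rw [hsum, hsum, Finset.sum_insert haS]; abel
      rw [hsplit, hgper l a (kv a) _ (hmemS S v hv), ih v hv]
  -- the descended roots off the axes
  set f₀ : Fin n → (Fin d → ℂ) → ℂ := fun l Y => g l (LOG Y) with hf₀
  have hf₀prod : ∀ Y ∈ U \ Ax,
      (X ^ n + ∑ k : Fin n, C (A k (fun i => Y i ^ q)) * X ^ (k : ℕ)) = ∏ l, (X - C (f₀ l Y)) := by
    intro Y hY
    have h1 := hgprod (LOG Y) (hLOGH Y hY)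
    have hY' : ∀ i, Y i ≠ 0 := by rw [hUA] at hY; exact hY.2
    simp only [hb, hEXPLOG Y hY'] at h1
    exact h1
  -- holomorphy off the axes: locally `f₀ l = g l ∘ (holomorphic branch of q log)`
  have hf₀d : ∀ l, DifferentiableOn ℂ (f₀ l) (U \ Ax) := by
    intro l Y₀ hY₀
    have hY₀' : ∀ i, Y₀ i ≠ 0 := by rw [hUA] at hY₀; exact hY₀.2
    -- local branch
    set Λ : (Fin d → ℂ) → (Fin d → ℂ) := fun Y i => (q : ℂ) * (log (Y i * (Y₀ i)⁻¹) + log (Y₀ i))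
      with hΛ
    -- near `Y₀`, `Y i / Y₀ i` is in the slit plane and no coordinate vanishes
    have hnear : ∀ᶠ Y in 𝓝 Y₀, Y ∈ U \ Ax ∧ ∀ i, Y i * (Y₀ i)⁻¹ ∈ slitPlane := by
      have hm : ∀ᶠ Y in 𝓝 Y₀, Y ∈ U \ Ax := hUAo.mem_nhds hY₀
      refine hm.and ((eventually_all).2 fun i => ?_)
      have hc1 : ContinuousAt (fun Y : Fin d → ℂ => Y i * (Y₀ i)⁻¹) Y₀ :=
        ((continuous_apply i).mul continuous_const).continuousAt
      have h1 : (fun Y : Fin d → ℂ => Y i * (Y₀ i)⁻¹) Y₀ ∈ slitPlane := by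
        simp [mul_inv_cancel₀ (hY₀' i)]
      exact hc1.preimage_mem_nhds (isOpen_slitPlane.mem_nhds h1)
    -- `f₀ l = g l ∘ Λ` near `Y₀`
    have heq : f₀ l =ᶠ[𝓝 Y₀] fun Y => g l (Λ Y) := by
      filter_upwards [hnear] with Y hY
      have hY' : ∀ i, Y i ≠ 0 := by have := hY.1; rw [hUA] at this; exact this.2
      -- the two logarithm vectors differ by integer periods
      have hdiff : ∀ i, ∃ kv : ℤ, Λ Y i = LOG Y i + (kv : ℂ) * ((q : ℂ) * c) := by
        intro i
        have h1 : exp (log (Y i * (Y₀ i)⁻¹) + log (Y₀ i)) = exp (log (Y i)) := by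
          rw [exp_add, exp_log (mul_ne_zero (hY' i) (inv_ne_zero (hY₀' i))), exp_log (hY₀' i),
            exp_log (hY' i), inv_mul_cancel_right₀ (hY₀' i)]
        obtain ⟨kv, hkv⟩ := exp_eq_exp_iff_exists_int.1 h1
        refine ⟨kv, ?_⟩
        simp only [hΛ, hLOG]
        rw [hkv, hc]; ring
      choose kv hkv using hdiff
      have hΛeq : Λ Y = LOG Y + fun j => (kv j : ℂ) * ((q : ℂ) * c) := funext fun j => hkv j
      simp only [hf₀]
      rw [hΛeq, hgperv l kv (LOG Y) (hLOGH Y hY.1)]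
    -- `g l ∘ Λ` is differentiable at `Y₀`
    have hΛd : DifferentiableAt ℂ Λ Y₀ := by
      refine differentiableAt_pi.2 fun i => ?_
      refine (DifferentiableAt.const_mul ?_ _)
      refine DifferentiableAt.add ?_ (differentiableAt_const _)
      refine ((differentiableAt_apply i Y₀).mul_const _).clog ?_
      simp [mul_inv_cancel₀ (hY₀' i)]
    have hΛY₀ : Λ Y₀ = LOG Y₀ := by
      funext i; simp only [hΛ, hLOG]; rw [mul_inv_cancel₀ (hY₀' i), log_one, zero_add]
    have hgat : DifferentiableAt ℂ (g l) (Λ Y₀) := by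
      rw [hΛY₀]
      exact (hgd l).differentiableAt ((isOpen_logSet hTo).mem_nhds (hLOGH Y₀ hY₀))
    have hcomp : DifferentiableAt ℂ (fun Y => g l (Λ Y)) Y₀ := hgat.comp Y₀ hΛd
    exact (heq.differentiableAt_iff.2 hcomp).differentiableWithinAt
  -- local boundedness near the axes (Cauchy bound, continuity of the coefficients)
  have hbdd' : ∀ l, ∀ x ∈ Ax ∩ U, ∃ W ∈ 𝓝 x, ∃ Cst : ℝ, ∀ Y ∈ W \ Ax, ‖f₀ l Y‖ ≤ Cst := by
    intro l x hx
    -- the coefficient bound is continuous on `U`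
    have hpow : Continuous (fun Y : Fin d → ℂ => fun i => Y i ^ q) :=
      continuous_pi fun i => (continuous_apply i).pow q
    have hAk : ∀ k, ContinuousAt (fun Y : Fin d → ℂ => A k (fun i => Y i ^ q)) x := fun k =>
      ((hA k).continuousOn.continuousAt (hDo.mem_nhds (hpowD x hx.2))).comp hpow.continuousAt
    have hcont : ContinuousAt (fun Y : Fin d → ℂ => ∑ k : Fin n, ‖A k (fun i => Y i ^ q)‖) x :=
      tendsto_finsetSum _ fun k _ => (hAk k).norm
    set M : ℝ := ∑ k : Fin n, ‖A k (fun i => x i ^ q)‖ with hM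
    have hev : ∀ᶠ Y in 𝓝 x, (∑ k : Fin n, ‖A k (fun i => Y i ^ q)‖) < M + 1 :=
      hcont.eventually (gt_mem_nhds (by linarith))
    refine ⟨{Y | (∑ k : Fin n, ‖A k (fun i => Y i ^ q)‖) < M + 1} ∩ U, inter_mem hev (hUo.mem_nhds hx.2),
      max 1 (M + 1), fun Y hY => ?_⟩
    have hYU : Y ∈ U \ Ax := ⟨hY.1.2, hY.2⟩
    have hroot : (X ^ n + ∑ k : Fin n, C (A k (fun i => Y i ^ q)) * X ^ (k : ℕ)).IsRoot (f₀ l Y) := by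
      rw [hf₀prod Y hYU, IsRoot.def, eval_prod]
      exact Finset.prod_eq_zero (Finset.mem_univ l) (by simp)
    exact (norm_root_le _ hroot).trans (max_le_max le_rfl hY.1.1.le)
  -- thinness of the axes
  have hthin : ∀ a ∈ Ax ∩ U, ∃ (φ : (Fin d → ℂ) → ℂ) (W : Set (Fin d → ℂ)), IsOpen W ∧ a ∈ W ∧ W ⊆ U ∧
      DifferentiableOn ℂ φ W ∧ (∀ x ∈ Ax ∩ W, φ x = 0) ∧ ¬ φ =ᶠ[𝓝 a] 0 := by
    intro a ha
    refine ⟨fun Y => ∏ i, Y i, U, hUo, ha.2, le_rfl, ?_, ?_, not_eventually_prod_eq_zero a⟩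
    · intro Y _
      exact (HasFDerivAt.finsetProd (u := Finset.univ) (g := fun (i : Fin d) (Y : Fin d → ℂ) => Y i)
        (fun i _ => hasFDerivAt_apply i Y)).differentiableAt.differentiableWithinAt
    · rintro Y ⟨⟨i, hi⟩, -⟩
      exact Finset.prod_eq_zero (Finset.mem_univ i) hi
  -- Riemann extension of each descended root
  have hext : ∀ l, ∃ fl : (Fin d → ℂ) → ℂ, DifferentiableOn ℂ fl U ∧ EqOn fl (f₀ l) (U \ Ax) :=
    fun l => SCV.exists_differentiableOn_eqOn_of_thin hUAo hthin (hf₀d l) (hbdd' l)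
  choose f hfd hfeq using hext
  refine ⟨q, hqpos, f, hfd, fun Y hY => ?_⟩
  -- the factorisation on all of `U`, by density of `U \ Ax` and continuity
  apply Polynomial.funext
  intro z
  have h1 : ContinuousOn (fun Y : Fin d → ℂ =>
      (X ^ n + ∑ k : Fin n, C (A k (fun i => Y i ^ q)) * X ^ (k : ℕ)).eval z) U := by
    have : (fun Y : Fin d → ℂ => (X ^ n + ∑ k : Fin n, C (A k (fun i => Y i ^ q)) * X ^ (k : ℕ)).eval z)
        = fun Y => z ^ n + ∑ k : Fin n, A k (fun i => Y i ^ q) * z ^ (k : ℕ) := by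
      funext Y; simp [eval_finsetSum]
    rw [this]
    refine continuousOn_const.add (continuousOn_finsetSum _ fun k _ => ?_)
    refine ContinuousOn.mul ?_ continuousOn_const
    exact (hA k).continuousOn.comp (continuous_pi fun i => (continuous_apply i).pow q).continuousOn
      hpowD
  have h2 : ContinuousOn (fun Y : Fin d → ℂ => (∏ l, (X - C (f l Y))).eval z) U := by
    have : (fun Y : Fin d → ℂ => (∏ l, (X - C (f l Y)) : ℂ[X]).eval z) = fun Y => ∏ l, (z - f l Y) := by
      funext Y; simp [eval_prod]
    rw [this]
    exact continuousOn_finsetProd _ fun l _ => continuousOn_const.sub (hfd l).continuousOn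
  have h3 : EqOn (fun Y : Fin d → ℂ =>
      (X ^ n + ∑ k : Fin n, C (A k (fun i => Y i ^ q)) * X ^ (k : ℕ)).eval z)
      (fun Y => (∏ l, (X - C (f l Y))).eval z) (U \ Ax) := by
    intro Y hY
    simp only
    rw [hf₀prod Y hY]
    congr 1
    exact Finset.prod_congr rfl fun l _ => by rw [hfeq l hY]
  exact SCV.eqOn_of_eqOn_diff_of_thin hUo hthin h1 h2 h3 hY

end AbhyankarJung
end Literature.Analysis.Complex

end
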